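import Mathlib.Algebra.Order.Chebyshev
import Literature.NumberTheory.LFunctions.ZeroGaps
import Literature.NumberTheory.LFunctions.ZetaArgVariation
import HarnessLib

/-!
# Selberg–Fujii large gaps: Heath-Brown's deduction (Titchmarsh §9.26) — proofs

Trunk T-ANT (`Literature/NumberTheory/LFunctions`). Proofs only (no definitions, no named facts).
Companion of `ZeroGaps.lean`, which records the large-gap half (9.25.5) of the Selberg–Fujii
theorem as the named fact `Literature.NumberTheory.LFunctions.selberg_fujii_large_gaps`
("`(γ_{n+1} − γ_n)/(2π/log γ_n) ≥ λ` for a positive proportion of `n`", some `λ > 1`), and of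
`ZeroGapsProofs.lean` (`selberg_fujii_small_gaps_of_large_gaps`, the last paragraph of §9.26).

## Main result

* `Literature.NumberTheory.LFunctions.selberg_fujii_large_gaps_of_first_moment` — the first part
  of Heath-Brown's proof sketch in Titchmarsh §9.26, PROVED: the named fact
  `selberg_fujii_large_gaps` follows from the two analytic inputs of §9.26, taken as explicit
  hypotheses (they are the deep part — Selberg 1946, Fujii 1975 — and are not proved here,
  nor vendored as named facts):
  1. (9.26.1) `∫_T^{2T} |N(t + 2πλ/log T) − N(t) − λ| dt ≥ c T` for `T ≥ T₁`, uniformly in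
     `1 ≤ λ ≤ 2` (which §9.26 obtains from Fujii's moment estimates (9.25.2)–(9.25.3) for
     `S(t + h) − S(t)` and Hölder's inequality);
  2. (9.25.4) with `k = 2`: `Σ_{0 < γ_n ≤ T} (γ_{n+1} − γ_n)² ≤ C N(T)/(log T)²` for `T ≥ T₂`.
  Everything else that §9.26 uses is the Riemann–von Mangoldt formula, proved in the tree
  (`riemann_von_mangoldt_holds`, `ZetaArgVariation.lean`), through the bookkeeping of
  `ZeroCountingProofs.lean`. Combined with `selberg_fujii_small_gaps_of_large_gaps`, both named
  facts of `ZeroGaps.lean` are thereby reduced to inputs 1–2.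

## The proof (Titchmarsh §9.26, with explicit constants)

Fix `λ = min(2, 1 + c/4)`, `ℓ = 2πλ/log T`, `δ(t) = N(t + ℓ) − N(t) − λ` and
`I = {t ∈ [T, 2T] : N(t + ℓ) = N(t)}`.
* (`SelbergFujii.abs_sub_sub_le`, `SelbergFujii.integral_abs_le`) pointwise
  `|δ| ≤ δ + (2λ − 2) + 2·1_I` (since `N(t+ℓ) − N(t) ∈ ℕ` and `λ ≥ 1`), integrated over `[T, 2T]`;
* (`SelbergFujii.integral_zetaZeroCount_shift_sub_le`) `∫_T^{2T} (N(t+ℓ) − N(t)) dt =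
  ∫_{2T}^{2T+ℓ} N − ∫_T^{T+ℓ} N ≤ ℓ (N(2T+1) − N(T))`, and
  (`SelbergFujii.exists_zetaZeroCount_two_mul_add_one_le`) `N(2T+1) − N(T) ≤ (T/2π) log T + K T`
  (Riemann–von Mangoldt), so `∫_T^{2T} δ ≤ 2πλ K T/log T ≤ cT/4` for `log T ≥ 16πK/c`; with
  input 1 this gives `m(I) ≥ cT/8`;
* (`SelbergFujii.volume_real_le_sum_gaps`) every `t ∈ I` lies in a gap `[γ_n, γ_{n+1}]` with
  `n < N(2T)`, `γ_{n+1} − γ_n ≥ ℓ` and `γ_n > t − C₀ ≥ T/2`, where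
  (`SelbergFujii.exists_zetaZeroCount_lt_add`) `N(t + C₀) > N(t)` for large `t` is again
  Riemann–von Mangoldt; so `m(I) ≤ Σ_{n ∈ S} (γ_{n+1} − γ_n)` over the set `S` of such `n`;
* Cauchy–Schwarz (`sq_sum_le_card_mul_sum_sq`) and input 2 at `2T`:
  `(cT/8)² ≤ #S · 2 C⁺C' T/log T` (`N(2T) ≤ C'·2T log 2T`), i.e. `#S ≥ c² T log T/(128 C⁺ C')
  ≥ A N(2T)` with `A = c²/(512 C⁺ C'²)`, `C⁺ = max(C, 1)`;
* (`SelbergFujii.le_zetaNormalizedGap_of_le_gap`) for `n ∈ S`,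
  `δ_n = (γ_{n+1} − γ_n) log γ_n/2π ≥ λ log(T/2)/log T ≥ (1 + λ)/2 =: l > 1` once
  `log T ≥ 2λ log 2/(λ − 1)`.
Hence `#{n < N(T') : δ_n ≥ l} ≥ A N(T')` for all large `T' = 2T`, which is (9.25.5) as recorded.
(The source runs the window `T ≤ γ_n ≤ 2T`; the indices `n < N(2T)` with `γ_n ≥ T/2` used here
are a superset of that window and a subset of `n < N(T')`, which is all (9.25.5) asks.)

## Design choices

* The two inputs are hypotheses written out in the binder, in the form printed in Titchmarsh
  ((9.26.1) and (9.25.4) with `k = 2`), not new `def … : Prop` named facts (D-0026: this file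
  discharges nothing and mints nothing; it is the glue that reduces `selberg_fujii_large_gaps` to
  its published analytic inputs).
* All counts are `Finset.card` of filters of `Finset.range (zetaZeroCount _)` and all integrals
  are interval integrals `∫ t in T..2T` against Lebesgue measure, as in `ZeroGaps.lean` /
  `ZeroStatistics.lean`; `N` is monotone hence measurable and interval-integrable, so no
  integrability hypothesis appears.

## References

* E. C. Titchmarsh, *The Theory of the Riemann Zeta-Function*, 2nd ed. revised by
  D. R. Heath-Brown (1986), §9.25 (9.25.2)–(9.25.5) and §9.26 (proof sketch, (9.26.1)–(9.26.2)),
  Thm. 9.4 (Riemann–von Mangoldt). [key `Titchmarsh1986`]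
* A. Fujii, *On the distribution of the zeros of the Riemann zeta function in short intervals*,
  Bull. Amer. Math. Soc. 81 (1975), 139–142 (Titchmarsh's Fujii [1]: (9.25.2)–(9.25.3));
  *On the difference between r consecutive ordinates of the zeros of the Riemann zeta function*,
  Proc. Japan Acad. 51 (1975), 741–743 (Titchmarsh's Fujii [2]: (9.25.4)–(9.25.6)).
* A. Selberg, *Contributions to the theory of the Riemann zeta-function*, Arch. Math. Naturvid.
  48 (1946), no. 5, 89–155.
-/

noncomputable section

open Real MeasureTheory Set Filter Asymptotics

namespace Literature.NumberTheory.LFunctions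

namespace SelbergFujii

/-! ### Consequences of the Riemann–von Mangoldt formula -/

/-- `N` is monotone (real-valued form). [folklore] -/
theorem monotone_zetaZeroCount_real : Monotone fun t : ℝ ↦ (zetaZeroCount t : ℝ) := by
  intro a b hab
  have h := zetaZeroCountRe_mono_right_holds 0 hab
  show (zetaZeroCountRe 0 a : ℝ) ≤ zetaZeroCountRe 0 b
  exact_mod_cast h

/-- The Riemann–von Mangoldt formula with an explicit eventual constant:
`|N(T) − (T/2π) log(T/2π) + T/2π| ≤ K₀ log T` for `T ≥ T₀ ≥ 1`. [cite: Titchmarsh1986, Thm. 9.4] -/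
theorem exists_abs_zetaZeroCount_sub_le :
    ∃ K₀ : ℝ, 0 < K₀ ∧ ∃ T₀ : ℝ, 1 ≤ T₀ ∧ ∀ T : ℝ, T₀ ≤ T →
      |(zetaZeroCount T : ℝ) - (T / (2 * π) * Real.log (T / (2 * π)) - T / (2 * π))| ≤
        K₀ * Real.log T := by
  have h := riemann_von_mangoldt_holds
  rw [riemann_von_mangoldt] at h
  obtain ⟨K₀, hK₀, h⟩ := h.exists_pos
  obtain ⟨T₀, hT₀⟩ := eventually_atTop.1 (h.bound.and (eventually_ge_atTop (1 : ℝ)))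
  refine ⟨K₀, hK₀, max T₀ 1, le_max_right _ _, fun T hT ↦ ?_⟩
  obtain ⟨h1, h2⟩ := hT₀ T ((le_max_left _ _).trans hT)
  rw [Real.norm_eq_abs, Real.norm_eq_abs, abs_of_nonneg (Real.log_nonneg h2)] at h1
  exact h1

/-- `N(2T + 1) ≤ N(T) + (T/2π) log T + K T` for all large `T` (Riemann–von Mangoldt).
[cite: Titchmarsh1986, Thm. 9.4] -/
theorem exists_zetaZeroCount_two_mul_add_one_le :
    ∃ K : ℝ, 0 < K ∧ ∃ T₀ : ℝ, ∀ T : ℝ, T₀ ≤ T →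
      (zetaZeroCount (2 * T + 1) : ℝ) ≤
        zetaZeroCount T + T / (2 * π) * Real.log T + K * T := by
  obtain ⟨K₀, hK₀, T₀, hT₀, h⟩ := exists_abs_zetaZeroCount_sub_le
  refine ⟨2 + 4 * K₀, by positivity, T₀, fun T hT ↦ ?_⟩
  have hT1 : 1 ≤ T := hT₀.trans hT
  have hπ : 3 < π := Real.pi_gt_three
  have h1 := (abs_le.1 (h (2 * T + 1) (by linarith))).2
  have h2 := (abs_le.1 (h T hT)).1
  have hlogT : Real.log T ≤ T := (Real.log_le_sub_one_of_pos (by linarith)).trans (by linarith)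
  have hlogT0 : 0 ≤ Real.log T := Real.log_nonneg hT1
  have hlog2T : Real.log (2 * T + 1) ≤ 2 * T :=
    (Real.log_le_sub_one_of_pos (by linarith)).trans (by linarith)
  have hlog2π : Real.log (2 * π) ≤ 2 * π := 
    (Real.log_le_sub_one_of_pos (by linarith)).trans (by linarith)
  -- the main term at `2T + 1`
  have hq : (2 * T + 1) / (2 * π) ≤ T := by
    rw [div_le_iff₀ (by positivity)]; nlinarith
  have hlogq : Real.log ((2 * T + 1) / (2 * π)) ≤ Real.log T :=
    Real.log_le_log (by positivity) hq
  have hL1 : (2 * T + 1) / (2 * π) * Real.log ((2 * T + 1) / (2 * π)) - (2 * T + 1) / (2 * π) ≤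
      (2 * T + 1) / (2 * π) * Real.log T :=
    (sub_le_self _ (by positivity)).trans (mul_le_mul_of_nonneg_left hlogq (by positivity))
  -- the main term at `T`
  have hL2 : T / (2 * π) * Real.log (T / (2 * π)) - T / (2 * π) =
      T / (2 * π) * Real.log T - T / (2 * π) * (Real.log (2 * π) + 1) := by
    rw [Real.log_div (by positivity) (by positivity)]; ring
  rw [hL2] at h2
  have ha : T / (2 * π) ≤ T / 6 :=
    div_le_div_of_nonneg_left (by linarith) (by norm_num) (by linarith)
  have hb : (2 * T + 1) / (2 * π) * Real.log T = 2 * (T / (2 * π) * Real.log T) +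
      Real.log T / (2 * π) := by ring
  have hc : Real.log T / (2 * π) ≤ T / 6 :=
    (div_le_div_of_nonneg_left hlogT0 (by norm_num) (by linarith)).trans
      (div_le_div_of_nonneg_right hlogT (by norm_num))
  have hd : T / (2 * π) * (Real.log (2 * π) + 1) ≤ T / (2 * π) * (2 * π + 1) :=
    mul_le_mul_of_nonneg_left (by linarith) (by positivity)
  have he : T / (2 * π) * (2 * π + 1) = T + T / (2 * π) := by
    field_simp
  have hf : K₀ * Real.log (2 * T + 1) ≤ K₀ * (2 * T) := mul_le_mul_of_nonneg_left hlog2T hK₀.le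
  have hg : K₀ * Real.log T ≤ K₀ * T := mul_le_mul_of_nonneg_left hlogT hK₀.le
  have hh : 0 ≤ K₀ * T := mul_nonneg hK₀.le (by linarith)
  linarith

/-- Bounded gaps from Riemann–von Mangoldt: there is `C₀ > 0` with `N(t) < N(t + C₀)` for all
large `t`. [cite: Titchmarsh1986, Thm. 9.4] -/
theorem exists_zetaZeroCount_lt_add :
    ∃ C₀ : ℝ, 0 < C₀ ∧ ∃ T₀ : ℝ, ∀ t : ℝ, T₀ ≤ t → zetaZeroCount t < zetaZeroCount (t + C₀) := by
  obtain ⟨K₀, hK₀, T₀, hT₀, h⟩ := exists_abs_zetaZeroCount_sub_le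
  have hπ : 3 < π := Real.pi_gt_three
  set C₀ : ℝ := 2 * π * (2 * K₀ + 2) with hC₀
  have hC₀pos : 0 < C₀ := by positivity
  refine ⟨C₀, hC₀pos, max (max T₀ C₀) (Real.exp ((K₀ + 1) * (Real.log (2 * π) + 1) + K₀)),
    fun t ht ↦ ?_⟩
  have ht₀ : T₀ ≤ t := ((le_max_left _ _).trans (le_max_left _ _)).trans ht
  have htC : C₀ ≤ t := ((le_max_right _ _).trans (le_max_left _ _)).trans ht
  have ht1 : 1 ≤ t := hT₀.trans ht₀
  have hlogt : (K₀ + 1) * (Real.log (2 * π) + 1) + K₀ ≤ Real.log t := by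
    rw [← Real.log_exp ((K₀ + 1) * (Real.log (2 * π) + 1) + K₀)]
    exact Real.log_le_log (Real.exp_pos _) ((le_max_right _ _).trans ht)
  have h1 := (abs_le.1 (h t ht₀)).2
  have h2 := (abs_le.1 (h (t + C₀) (by linarith))).1
  suffices hlt : (zetaZeroCount t : ℝ) < zetaZeroCount (t + C₀) by exact_mod_cast hlt
  have hlog2 : Real.log 2 < 1 := by have := Real.log_two_lt_d9; linarith
  have hlogtC : Real.log (t + C₀) ≤ Real.log 2 + Real.log t := by
    rw [← Real.log_mul (by norm_num) (by positivity)]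
    exact Real.log_le_log (by positivity) (by linarith)
  have hmono : (t + C₀) / (2 * π) * Real.log (t / (2 * π)) ≤
      (t + C₀) / (2 * π) * Real.log ((t + C₀) / (2 * π)) :=
    mul_le_mul_of_nonneg_left (Real.log_le_log (by positivity)
      (div_le_div_of_nonneg_right (by linarith) (by positivity))) (by positivity)
  have hsplit : Real.log (t / (2 * π)) = Real.log t - Real.log (2 * π) :=
    Real.log_div (by positivity) (by positivity)
  have hkey : (t + C₀) / (2 * π) * Real.log (t / (2 * π)) - (t + C₀) / (2 * π) -
      (t / (2 * π) * Real.log (t / (2 * π)) - t / (2 * π)) =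
      (2 * K₀ + 2) * (Real.log t - Real.log (2 * π) - 1) := by
    rw [hsplit, hC₀]; field_simp; ring
  nlinarith [mul_nonneg hK₀.le (Real.log_nonneg ht1), hkey, mul_le_mul_of_nonneg_left hlogtC hK₀.le]


/-- `1 ≤ N(T)` and `N(T) ≤ C' T log T` for all large `T` (Riemann–von Mangoldt, crude forms).
[cite: Titchmarsh1986, Thm. 9.4] -/
theorem exists_one_le_zetaZeroCount_le :
    ∃ C' : ℝ, 0 < C' ∧ ∃ T₀ : ℝ, ∀ T : ℝ, T₀ ≤ T →
      1 ≤ zetaZeroCount T ∧ (zetaZeroCount T : ℝ) ≤ C' * (T * Real.log T) := by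
  obtain ⟨C', hC', h⟩ := riemann_von_mangoldt_holds.eventually_le_mul
  obtain ⟨T₀, hT₀⟩ := eventually_atTop.1
    ((h.and riemann_von_mangoldt_holds.eventually_self_le).and (eventually_ge_atTop (1 : ℝ)))
  refine ⟨C', hC', T₀, fun T hT ↦ ⟨?_, (hT₀ T hT).1.1⟩⟩
  obtain ⟨⟨-, h2⟩, h3⟩ := hT₀ T hT
  exact_mod_cast h3.trans h2

/-! ### The window `[T, 2T]`: integrals of the zero count -/

/-- Shifting the zero count: `∫_T^{2T} (N(t + ℓ) − N(t)) dt ≤ ℓ (N(2T + 1) − N(T))` for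
`0 ≤ ℓ ≤ 1`, `T ≥ 0` (the integral equals `∫_{2T}^{2T+ℓ} N − ∫_T^{T+ℓ} N` and `N` is monotone).
[folklore] -/
theorem integral_zetaZeroCount_shift_sub_le {T ℓ : ℝ} (hℓ : 0 ≤ ℓ) (hℓ1 : ℓ ≤ 1) :
    ∫ t in T..2 * T, ((zetaZeroCount (t + ℓ) : ℝ) - zetaZeroCount t) ≤
      ℓ * ((zetaZeroCount (2 * T + 1) : ℝ) - zetaZeroCount T) := by
  have hm := monotone_zetaZeroCount_real
  have hi : ∀ a b : ℝ, IntervalIntegrable (fun t : ℝ ↦ (zetaZeroCount t : ℝ)) volume a b :=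
    fun a b ↦ hm.intervalIntegrable
  have hm' : Monotone fun t : ℝ ↦ (zetaZeroCount (t + ℓ) : ℝ) := fun a b hab ↦
    hm (by linarith)
  have hi' : ∀ a b : ℝ, IntervalIntegrable (fun t : ℝ ↦ (zetaZeroCount (t + ℓ) : ℝ)) volume a b :=
    fun a b ↦ hm'.intervalIntegrable
  rw [intervalIntegral.integral_sub (hi' _ _) (hi _ _),
    intervalIntegral.integral_comp_add_right (fun t : ℝ ↦ (zetaZeroCount t : ℝ)) ℓ]
  have e1 := intervalIntegral.integral_add_adjacent_intervals (hi (T + ℓ) (2 * T)) (hi (2 * T) (2 * T + ℓ))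
  have e2 := intervalIntegral.integral_add_adjacent_intervals (hi T (T + ℓ)) (hi (T + ℓ) (2 * T))
  have b1 := intervalIntegral.integral_mono_on (by linarith) (hi (2 * T) (2 * T + ℓ))
    intervalIntegrable_const
    (fun t ht ↦ (hm (by linarith [ht.2]) : (zetaZeroCount t : ℝ) ≤ zetaZeroCount (2 * T + 1)))
  have b2 := intervalIntegral.integral_mono_on (by linarith) intervalIntegrable_const (hi T (T + ℓ))
    (fun t ht ↦ (hm ht.1 : (zetaZeroCount T : ℝ) ≤ zetaZeroCount t))
  rw [intervalIntegral.integral_const, smul_eq_mul] at b1 b2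
  have e3 : 2 * T + ℓ - 2 * T = ℓ := by ring
  have e4 : T + ℓ - T = ℓ := by ring
  rw [e3] at b1
  rw [e4] at b2
  linarith

/-- The pointwise inequality of §9.26: for naturals `a ≤ b`, `λ ≥ 1` and `δ = b − a − λ`,
`|δ| ≤ δ + (2λ − 2) + 2·[b = a]`. [cite: Titchmarsh1986, §9.26] -/
theorem abs_sub_sub_le {a b : ℕ} (hab : a ≤ b) {l : ℝ} (hl : 1 ≤ l) (x : ℝ)
    (hx : ((b : ℝ) = a → x = 1) ∧ ((b : ℝ) ≠ a → x = 0)) :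
    |(b : ℝ) - a - l| ≤ ((b : ℝ) - a - l) + (2 * l - 2) + 2 * x := by
  by_cases h : (b : ℝ) = a
  · rw [hx.1 h, h, sub_self, zero_sub, abs_neg, abs_of_pos (by linarith)]
    linarith
  · rw [hx.2 h]
    have hlt : a < b := lt_of_le_of_ne hab fun he ↦ h (by rw [he])
    have h1 : (a : ℝ) + 1 ≤ b := by exact_mod_cast hlt
    exact abs_le.2 ⟨by linarith, by linarith⟩

/-- Integrating the pointwise inequality over `[T, 2T]`: with
`I = {t ∈ [T, 2T] | N(t + ℓ) = N(t)}`,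
`∫_T^{2T} |N(t+ℓ) − N(t) − λ| dt ≤ ∫_T^{2T} (N(t+ℓ) − N(t)) dt − λT + (2λ − 2)T + 2 m(I)`.
[cite: Titchmarsh1986, §9.26] -/
theorem integral_abs_le {T ℓ l : ℝ} (hT : 0 ≤ T) (hℓ : 0 ≤ ℓ) (hl : 1 ≤ l) :
    ∫ t in T..2 * T, |(zetaZeroCount (t + ℓ) : ℝ) - zetaZeroCount t - l| ≤
      (∫ t in T..2 * T, ((zetaZeroCount (t + ℓ) : ℝ) - zetaZeroCount t)) - l * T +
        (2 * l - 2) * T +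
        2 * volume.real ({t | (zetaZeroCount (t + ℓ) : ℝ) = zetaZeroCount t} ∩ Icc T (2 * T)) := by
  set I : Set ℝ := {t | (zetaZeroCount (t + ℓ) : ℝ) = zetaZeroCount t} ∩ Icc T (2 * T) with hIdef
  have hm := monotone_zetaZeroCount_real
  have hm' : Monotone fun t : ℝ ↦ (zetaZeroCount (t + ℓ) : ℝ) := fun a b hab ↦
    hm (by linarith)
  have hI : MeasurableSet I :=
    (measurableSet_eq_fun hm'.measurable hm.measurable).inter measurableSet_Icc
  have hδ : IntervalIntegrable (fun t : ℝ ↦ (zetaZeroCount (t + ℓ) : ℝ) - zetaZeroCount t - l)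
      volume T (2 * T) :=
    (hm'.intervalIntegrable.sub hm.intervalIntegrable).sub intervalIntegrable_const
  have hvolI : volume I ≠ ⊤ :=
    (measure_mono (Set.inter_subset_right) |>.trans_lt measure_Icc_lt_top).ne
  have hind : IntervalIntegrable (I.indicator fun _ : ℝ ↦ (1 : ℝ)) volume T (2 * T) := by
    rw [intervalIntegrable_iff_integrableOn_Ioc_of_le (by linarith)]
    exact ((integrable_indicator_iff hI).2
      (integrableOn_const (hs := hvolI))).integrableOn
  have hpt : ∀ t ∈ Icc T (2 * T),
      |(zetaZeroCount (t + ℓ) : ℝ) - zetaZeroCount t - l| ≤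
        ((zetaZeroCount (t + ℓ) : ℝ) - zetaZeroCount t - l) + (2 * l - 2) +
          2 * I.indicator (fun _ : ℝ ↦ (1 : ℝ)) t := by
    intro t ht
    refine abs_sub_sub_le (zetaZeroCountRe_mono_right_holds 0 (by linarith)) hl _ ⟨?_, ?_⟩
    · intro h
      have hmem : t ∈ I := ⟨h, ht⟩
      simp [hmem]
    · intro h
      have hnm : t ∉ I := fun hmem ↦ h hmem.1
      simp [hnm]
  have hmono := intervalIntegral.integral_mono_on (by linarith) hδ.abs
    ((hδ.add intervalIntegrable_const).add (hind.const_mul 2)) hpt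
  refine hmono.trans ?_
  rw [intervalIntegral.integral_add (hδ.add intervalIntegrable_const) (hind.const_mul 2),
    intervalIntegral.integral_add hδ intervalIntegrable_const,
    intervalIntegral.integral_sub (hm'.intervalIntegrable.sub hm.intervalIntegrable)
      intervalIntegrable_const,
    intervalIntegral.integral_const, intervalIntegral.integral_const,
    intervalIntegral.integral_const_mul, smul_eq_mul, smul_eq_mul]
  have hle : ∫ t in T..2 * T, I.indicator (fun _ : ℝ ↦ (1 : ℝ)) t ≤ volume.real I := by
    rw [intervalIntegral.integral_of_le (by linarith), integral_indicator hI, setIntegral_const,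
      smul_eq_mul, mul_one, measureReal_restrict_apply hI]
    exact measureReal_mono Set.inter_subset_left hvolI
  nlinarith

/-! ### The set `I` is covered by the large gaps -/

/-- If `N(t + ℓ) = N(t)` for some `t ∈ [T, 2T]`, then `t` lies in a gap `[γ_n, γ_{n+1}]` of length
`≥ ℓ` with `n < N(2T)` and `γ_n ≥ T/2` (for `T` large); hence
`m(I) ≤ Σ_{n ∈ S} (γ_{n+1} − γ_n)` over such `n`. [cite: Titchmarsh1986, §9.26] -/
theorem volume_real_le_sum_gaps {T ℓ C₀ T₄ : ℝ} (hℓ : 0 ≤ ℓ)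
    (hC₀ : ∀ t : ℝ, T₄ ≤ t → zetaZeroCount t < zetaZeroCount (t + C₀))
    (hT₄ : T₄ ≤ T - C₀) (hTC : 2 * C₀ ≤ T) (hN : 1 ≤ zetaZeroCount T) :
    volume.real ({t | (zetaZeroCount (t + ℓ) : ℝ) = zetaZeroCount t} ∩ Icc T (2 * T)) ≤
      ∑ n ∈ (Finset.range (zetaZeroCount (2 * T))).filter
          (fun n ↦ T / 2 ≤ zetaOrdinate n ∧ ℓ ≤ zetaOrdinate (n + 1) - zetaOrdinate n),
        (zetaOrdinate (n + 1) - zetaOrdinate n) := by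
  classical
  set S := (Finset.range (zetaZeroCount (2 * T))).filter
      (fun n ↦ T / 2 ≤ zetaOrdinate n ∧ ℓ ≤ zetaOrdinate (n + 1) - zetaOrdinate n) with hS
  have hrvm := riemann_von_mangoldt_holds
  have hsub : {t | (zetaZeroCount (t + ℓ) : ℝ) = zetaZeroCount t} ∩ Icc T (2 * T) ⊆
      ⋃ n ∈ S, Icc (zetaOrdinate n) (zetaOrdinate (n + 1)) := by
    rintro t ⟨ht, hT1, hT2⟩
    have ht' : zetaZeroCount (t + ℓ) = zetaZeroCount t := by exact_mod_cast ht
    have hk : 1 ≤ zetaZeroCount t := hN.trans (zetaZeroCountRe_mono_right_holds 0 hT1)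
    obtain ⟨n, hn⟩ : ∃ n, zetaZeroCount t = n + 1 := ⟨zetaZeroCount t - 1, by omega⟩
    have h1 : zetaOrdinate n ≤ t := hrvm.zetaOrdinate_le_iff.2 hn.ge
    have h2 : t + ℓ < zetaOrdinate (n + 1) := by
      by_contra h
      rw [not_lt] at h
      have := hrvm.zetaOrdinate_le_iff.1 h
      omega
    have h3 : t - C₀ < zetaOrdinate n := by
      by_contra h
      rw [not_lt] at h
      have h5 := hrvm.zetaOrdinate_le_iff.1 h
      have h6 := hC₀ (t - C₀) (by linarith)
      rw [sub_add_cancel] at h6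
      omega
    have h4 : zetaZeroCount t ≤ zetaZeroCount (2 * T) := zetaZeroCountRe_mono_right_holds 0 hT2
    simp only [Set.mem_iUnion, Set.mem_Icc, exists_prop]
    refine ⟨n, ?_, h1, by linarith⟩
    simp only [hS, Finset.mem_filter, Finset.mem_range]
    exact ⟨by omega, by linarith, by linarith⟩
  calc volume.real ({t | (zetaZeroCount (t + ℓ) : ℝ) = zetaZeroCount t} ∩ Icc T (2 * T))
      ≤ volume.real (⋃ n ∈ S, Icc (zetaOrdinate n) (zetaOrdinate (n + 1))) :=
        measureReal_mono hsub (measure_biUnion_lt_top S.finite_toSet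
          (fun n _ ↦ measure_Icc_lt_top)).ne
    _ ≤ ∑ n ∈ S, volume.real (Icc (zetaOrdinate n) (zetaOrdinate (n + 1))) :=
        measureReal_biUnion_finset_le _ _
    _ = ∑ n ∈ S, (zetaOrdinate (n + 1) - zetaOrdinate n) :=
        Finset.sum_congr rfl fun n _ ↦
          Real.volume_real_Icc_of_le (zetaOrdinate_mono_holds (Nat.le_succ n))

/-! ### Assembly -/

/-- A gap of length `≥ 2πλ/log T` starting at `γ_n ≥ T/2` is, in units of the mean spacing at
`γ_n`, at least `(1 + λ)/2`, once `log T ≥ 2λ log 2/(λ − 1)`. [folklore] -/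
theorem le_zetaNormalizedGap_of_le_gap {T lam : ℝ} {n : ℕ} (hlam : 1 < lam) (hT : 1 ≤ T)
    (hlogT : 4 * π ≤ Real.log T) (hlogl : 2 * lam * Real.log 2 / (lam - 1) ≤ Real.log T)
    (hn1 : T / 2 ≤ zetaOrdinate n)
    (hn2 : 2 * π * lam / Real.log T ≤ zetaOrdinate (n + 1) - zetaOrdinate n) :
    (1 + lam) / 2 ≤ zetaNormalizedGap n := by
  have hπ : 3 < π := Real.pi_gt_three
  have hlogpos : 0 < Real.log T := by linarith
  have hlog24 : Real.log 2 < 4 := by have := Real.log_two_lt_d9; linarith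
  rw [zetaNormalizedGap_eq_mul_div, le_div_iff₀ (by positivity)]
  have hγ : Real.log T - Real.log 2 ≤ Real.log (zetaOrdinate n) := by
    rw [← Real.log_div (by positivity) (by norm_num)]
    exact Real.log_le_log (by positivity) hn1
  have hγ0 : 0 ≤ Real.log (zetaOrdinate n) := by linarith
  have hℓγ : 2 * π * lam / Real.log T * Real.log (zetaOrdinate n) ≤
      (zetaOrdinate (n + 1) - zetaOrdinate n) * Real.log (zetaOrdinate n) :=
    mul_le_mul_of_nonneg_right hn2 hγ0
  have hcond : 2 * lam * Real.log 2 ≤ (lam - 1) * Real.log T := by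
    have := (div_le_iff₀ (by linarith : (0 : ℝ) < lam - 1)).1 hlogl; linarith
  have hℓlog : 2 * π * lam / Real.log T * (Real.log T - Real.log 2) =
      2 * π * lam - 2 * π * lam * Real.log 2 / Real.log T := by
    field_simp
  have hfrac : 2 * π * lam * Real.log 2 / Real.log T ≤ π * (lam - 1) := by
    rw [div_le_iff₀ hlogpos]; nlinarith
  have hmul := mul_le_mul_of_nonneg_left hγ (by positivity : (0 : ℝ) ≤ 2 * π * lam / Real.log T)
  linarith

/-- **Heath-Brown's deduction of the Selberg–Fujii large-gap theorem (Titchmarsh §9.26).**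
From the first-moment lower bound (9.26.1),
`∫_T^{2T} |N(t + 2πλ/log T) − N(t) − λ| dt ≥ c T` uniformly for `1 ≤ λ ≤ 2` and `T ≥ T₁`
(which §9.26 derives from Fujii's moment estimates (9.25.2)–(9.25.3) for `S(t+h) − S(t)` by
Hölder's inequality), and the case `k = 2` of (9.25.4),
`Σ_{0 < γ_n ≤ T} (γ_{n+1} − γ_n)² ≤ C N(T)/log² T` for `T ≥ T₂`, the named fact
`Literature.NumberTheory.LFunctions.selberg_fujii_large_gaps` ((9.25.5) for a positive proportion
of `n`) follows, using otherwise only the Riemann–von Mangoldt formula (proved in the tree,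
`riemann_von_mangoldt_holds`). The two hypotheses are the deep inputs (Selberg 1946, Fujii
1975) and are NOT proved here. [cite: Titchmarsh1986, §9.26 (9.26.1)–(9.26.2)] -/
theorem selberg_fujii_large_gaps_of_first_moment
    (h1 : ∃ c : ℝ, 0 < c ∧ ∃ T₁ : ℝ, ∀ T : ℝ, T₁ ≤ T → ∀ l : ℝ, 1 ≤ l → l ≤ 2 →
      c * T ≤ ∫ t in T..2 * T,
        |(zetaZeroCount (t + 2 * π * l / Real.log T) : ℝ) - zetaZeroCount t - l|)
    (h2 : ∃ C : ℝ, ∃ T₂ : ℝ, ∀ T : ℝ, T₂ ≤ T →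
      ∑ n ∈ Finset.range (zetaZeroCount T), (zetaOrdinate (n + 1) - zetaOrdinate n) ^ 2 ≤
        C * (zetaZeroCount T : ℝ) / (Real.log T) ^ 2) :
    selberg_fujii_large_gaps := by
  classical
  obtain ⟨c, hc, T₁, h1⟩ := h1
  obtain ⟨C, T₂, h2⟩ := h2
  obtain ⟨K, hK, T₃, hK3⟩ := exists_zetaZeroCount_two_mul_add_one_le
  obtain ⟨C₀, hC₀, T₄, hC₀4⟩ := exists_zetaZeroCount_lt_add
  obtain ⟨C', hC', T₅, hC'5⟩ := exists_one_le_zetaZeroCount_le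
  have hπ : 3 < π := Real.pi_gt_three
  -- the constants `λ = min(2, 1 + c/4)` and `C⁺ = max(C, 1)`
  obtain ⟨lam, hlam1, hlam2, hlamc⟩ : ∃ lam : ℝ, 1 < lam ∧ lam ≤ 2 ∧ lam ≤ 1 + c / 4 :=
    ⟨min 2 (1 + c / 4), lt_min (by norm_num) (by linarith), min_le_left _ _, min_le_right _ _⟩
  obtain ⟨Cp, hCp1, hCCp⟩ : ∃ Cp : ℝ, 1 ≤ Cp ∧ C ≤ Cp := ⟨max C 1, le_max_right _ _, le_max_left _ _⟩
  refine ⟨(1 + lam) / 2, by linarith, c ^ 2 / (512 * Cp * C' ^ 2), by positivity,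
    2 * max (max (max T₁ T₂) (max T₃ (max (T₄ + C₀) (2 * C₀))))
      (max (max T₅ (Real.exp (4 * π))) (max (Real.exp (16 * π * K / c))
        (Real.exp (2 * lam * Real.log 2 / (lam - 1))))),
    fun T' hT' ↦ ?_⟩
  obtain ⟨T, rfl⟩ : ∃ T, T' = 2 * T := ⟨T' / 2, by ring⟩
  have hT := le_of_mul_le_mul_left hT' (by norm_num : (0 : ℝ) < 2)
  simp only [max_le_iff] at hT
  obtain ⟨⟨⟨hT1, hT2⟩, hT3, hT4, hTC⟩, ⟨hT5, hTe⟩, hTK, hTl⟩ := hT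
  -- basic size facts
  have hT0 : 1 ≤ T := (Real.one_le_exp (by positivity)).trans hTe
  have hlogT : 4 * π ≤ Real.log T := by
    rw [← Real.log_exp (4 * π)]; exact Real.log_le_log (Real.exp_pos _) hTe
  have hlogpos : 0 < Real.log T := by linarith
  have hlogK : 16 * π * K / c ≤ Real.log T := by
    rw [← Real.log_exp (16 * π * K / c)]; exact Real.log_le_log (Real.exp_pos _) hTK
  have hlogl : 2 * lam * Real.log 2 / (lam - 1) ≤ Real.log T := by
    rw [← Real.log_exp (2 * lam * Real.log 2 / (lam - 1))]
    exact Real.log_le_log (Real.exp_pos _) hTl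
  have hlogT2T : Real.log T ≤ Real.log (2 * T) := Real.log_le_log (by positivity) (by linarith)
  have hlog2T : Real.log (2 * T) ≤ 2 * Real.log T := by
    rw [Real.log_mul (by norm_num) (by positivity)]
    have : Real.log 2 < 4 := by have := Real.log_two_lt_d9; linarith
    linarith
  -- the shift `ℓ = 2πλ / log T ≤ 1`
  obtain ⟨ℓ, hℓdef⟩ : ∃ ℓ : ℝ, ℓ = 2 * π * lam / Real.log T := ⟨_, rfl⟩
  have hℓpos : 0 < ℓ := by rw [hℓdef]; positivity
  have hℓ1 : ℓ ≤ 1 := by rw [hℓdef, div_le_one hlogpos]; nlinarith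
  -- Steps 1–3 of §9.26: `m(I) ≥ cT/8` for `I = {t ∈ [T,2T] | N(t+ℓ) = N(t)}`
  have hmI : c * T / 8 ≤
      volume.real ({t | (zetaZeroCount (t + ℓ) : ℝ) = zetaZeroCount t} ∩ Icc T (2 * T)) := by
    have hS1 := h1 T hT1 lam hlam1.le hlam2
    rw [← hℓdef] at hS1
    have hS2 := integral_abs_le (T := T) (ℓ := ℓ) (by linarith) hℓpos.le hlam1.le
    have hS3 := integral_zetaZeroCount_shift_sub_le (T := T) hℓpos.le hℓ1
    have hS4 := mul_le_mul_of_nonneg_left (hK3 T hT3) hℓpos.le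
    have hS4' : ℓ * (T / (2 * π) * Real.log T + K * T) =
        lam * T + 2 * π * lam * K * T / Real.log T := by
      rw [hℓdef]; field_simp
    have h16 : 16 * π * K ≤ c * Real.log T := by
      have := (div_le_iff₀ hc).1 hlogK; linarith
    have hS5 : 2 * π * lam * K * T / Real.log T ≤ c * T / 4 := by
      rw [div_le_iff₀ hlogpos]
      have hA : 2 * π * lam * K * T ≤ 2 * π * 2 * K * T := by gcongr
      have hB := mul_le_mul_of_nonneg_right h16 (by positivity : (0 : ℝ) ≤ T / 4)
      linarith
    have hlamT : (2 * lam - 2) * T ≤ c / 2 * T :=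
      mul_le_mul_of_nonneg_right (by linarith) (by linarith)
    linarith
  -- Step 4: `m(I) ≤ Σ_{n ∈ S} (γ_{n+1} − γ_n)`
  obtain ⟨hN1, -⟩ := hC'5 T hT5
  obtain ⟨-, hN2T⟩ := hC'5 (2 * T) (by linarith)
  set S := (Finset.range (zetaZeroCount (2 * T))).filter
      (fun n ↦ T / 2 ≤ zetaOrdinate n ∧ ℓ ≤ zetaOrdinate (n + 1) - zetaOrdinate n) with hSdef
  have hS6 : volume.real ({t | (zetaZeroCount (t + ℓ) : ℝ) = zetaZeroCount t} ∩ Icc T (2 * T)) ≤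
      ∑ n ∈ S, (zetaOrdinate (n + 1) - zetaOrdinate n) :=
    volume_real_le_sum_gaps hℓpos.le hC₀4 (by linarith) hTC hN1
  -- Step 5: Cauchy–Schwarz and (9.25.4) with `k = 2`
  have hCS := sq_sum_le_card_mul_sum_sq (s := S) (f := fun n ↦ zetaOrdinate (n + 1) - zetaOrdinate n)
  have hsq : ∑ n ∈ S, (zetaOrdinate (n + 1) - zetaOrdinate n) ^ 2 ≤
      2 * Cp * C' * T / Real.log T := by
    calc ∑ n ∈ S, (zetaOrdinate (n + 1) - zetaOrdinate n) ^ 2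
        ≤ ∑ n ∈ Finset.range (zetaZeroCount (2 * T)),
            (zetaOrdinate (n + 1) - zetaOrdinate n) ^ 2 :=
          Finset.sum_le_sum_of_subset_of_nonneg (Finset.filter_subset _ _)
            fun n _ _ ↦ sq_nonneg _
      _ ≤ C * (zetaZeroCount (2 * T) : ℝ) / Real.log (2 * T) ^ 2 := h2 (2 * T) (by linarith)
      _ ≤ Cp * (C' * (2 * T * Real.log (2 * T))) / Real.log (2 * T) ^ 2 := by
          apply div_le_div_of_nonneg_right _ (by positivity)
          calc C * (zetaZeroCount (2 * T) : ℝ) ≤ Cp * zetaZeroCount (2 * T) :=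
                mul_le_mul_of_nonneg_right hCCp (Nat.cast_nonneg _)
            _ ≤ Cp * (C' * (2 * T * Real.log (2 * T))) :=
                mul_le_mul_of_nonneg_left hN2T (by linarith)
      _ = 2 * Cp * C' * T / Real.log (2 * T) := by
          field_simp
      _ ≤ 2 * Cp * C' * T / Real.log T :=
          div_le_div_of_nonneg_left (by positivity) hlogpos hlogT2T
  have h7 : (c * T / 8) ^ 2 ≤ (S.card : ℝ) * (2 * Cp * C' * T / Real.log T) :=
    calc (c * T / 8) ^ 2
        ≤ (volume.real ({t | (zetaZeroCount (t + ℓ) : ℝ) = zetaZeroCount t} ∩ Icc T (2 * T))) ^ 2 := by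
          gcongr
      _ ≤ (∑ n ∈ S, (zetaOrdinate (n + 1) - zetaOrdinate n)) ^ 2 := by gcongr
      _ ≤ S.card * ∑ n ∈ S, (zetaOrdinate (n + 1) - zetaOrdinate n) ^ 2 := hCS
      _ ≤ (S.card : ℝ) * (2 * Cp * C' * T / Real.log T) := by gcongr
  have hkey : (c * T / 8) ^ 2 * Real.log T ≤ (S.card : ℝ) * (2 * Cp * C' * T) := by
    have := mul_le_mul_of_nonneg_right h7 hlogpos.le
    rwa [mul_assoc, div_mul_cancel₀ _ hlogpos.ne'] at this
  -- Step 6: `S ⊆ {n < N(2T) | (1+λ)/2 ≤ δ_n}` and the count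
  have hSsub : S ⊆ (Finset.range (zetaZeroCount (2 * T))).filter
      fun n ↦ (1 + lam) / 2 ≤ zetaNormalizedGap n :=
    Finset.monotone_filter_right _ fun n _ hn ↦
      le_zetaNormalizedGap_of_le_gap hlam1 hT0 hlogT hlogl hn.1 (hℓdef ▸ hn.2)
  have hcardR : (S.card : ℝ) ≤ ((Finset.range (zetaZeroCount (2 * T))).filter
      fun n ↦ (1 + lam) / 2 ≤ zetaNormalizedGap n).card := by
    exact_mod_cast Finset.card_le_card hSsub
  have hkey' : (c ^ 2 * T * Real.log T) * T ≤ ((S.card : ℝ) * (128 * Cp * C')) * T := by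
    linarith
  have hSlb : c ^ 2 * T * Real.log T / (128 * Cp * C') ≤ S.card := by
    rw [div_le_iff₀ (by positivity)]
    exact le_of_mul_le_mul_right hkey' (by linarith)
  calc c ^ 2 / (512 * Cp * C' ^ 2) * (zetaZeroCount (2 * T) : ℝ)
      ≤ c ^ 2 / (512 * Cp * C' ^ 2) * (C' * (2 * T * Real.log (2 * T))) := by gcongr
    _ ≤ c ^ 2 / (512 * Cp * C' ^ 2) * (C' * (2 * T * (2 * Real.log T))) := by gcongr
    _ = c ^ 2 * T * Real.log T / (128 * Cp * C') := by field_simp; ring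
    _ ≤ S.card := hSlb
    _ ≤ _ := hcardR

end SelbergFujii

end Literature.NumberTheory.LFunctions
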